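import Mathlib
import HarnessLib
import Summits.ResolutionOfSingularities.ResolutionOfSingularities.Theorems.WildQuotientsWildQuotientResolutionS1aRingKillDataOfCert

/-!
# S1a — THE KILL CRITERION WITH A GENERAL SHIFT `g = β · s^δ` (KC3_δ, KC2_δ, (a′)_δ on generators)

[OURS · L1 W4.5c · lead-1 g10; plan-1 g13 ASSIGNMENT v10.25 (3) «state the inhabitant lemma for GENERAL SHIFT g = β·s^δ (census trA needs δ = 3)»]
— NOT statements of the manuscript; counted 0; AI-level work, weaker than expert review. Crux stmt-ResolutionOfSingularities-17941 `CyclicQuotientFourfolds`,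
line `s1a-logminvertex` v10, K-side (`stub_killTouchReachAux`). The δ = 1 case is `…S1aKillCriterion` / `…S1aRingKillDataOfCert` (p636398 / p636674);
every proof is the same with `s ↦ s^δ`.

* `sigmaR_sub_eq_of_admissible_shift` — `y ∈ 𝒥ₙ`, `σ y − y = β j`, `j ∈ 𝒥ₙ₊δ` ⇒ `σ_R (ytⁿ) − ytⁿ = (β s^δ)·(j tⁿ⁺δ)`;
* `augmentationIdeal_sigmaR_le_span_of_admissible_shift` — (a′)_δ `y ∈ 𝒥ₙ ⇒ σ y − y ∈ β 𝒥ₙ₊δ` ⇒ (H1) for `g = β s^δ`;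
* `map_colon_le_colon_shift`, `exists_vertexIdeal_pow_le_colon_shift` — (i)_δ ∧ (ii) ⇒ (H2);
* ★★ `cobordantKillCert_of_admissible_of_irrelevant_shift` — KC3_δ: (a′)_δ ∧ (ii) ∧ (i)_δ (`vertexIdeal^N ≤ (augIdeal σ_R : β s^δ) ⊔ (s)`) ⇒
  `CobordantKillCert … (β s^δ)` (hence KC1: `augIdeal σʼ = (β s^δ)` on every σ-fixed chart);
* `map_le_of_admissible_shift`, `sub_mem_of_mul_shift`, ★ `admissible_shift_of_generators` — (a′)_δ from generators (`σ g − g ∈ β 𝒥_δ` on ring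
  generators, `σ fᵢ − fᵢ ∈ β 𝒥_{wᵢ+δ}` on the centre);
* ★★ `ringKillData_of_admissible_of_irrelevant_shift` — KC2 ∘ KC3_δ (the census trA root kill `(2,3)`, δ = 3, is of this shape).
-/

set_option linter.dupNamespace false

noncomputable section

open Literature.AlgebraicGeometry.Resolution
open scoped LaurentPolynomial
open LaurentPolynomial
open Summit.ResolutionOfSingularities.ResolutionOfSingularities.Theorems.WildQuotientResolution.S1.CoarseChart
open Summit.ResolutionOfSingularities.ResolutionOfSingularities.Theorems.WildQuotientResolution.S1.BlowupCharts

namespace Summit.ResolutionOfSingularities.ResolutionOfSingularities.Theorems.WildQuotientResolution.S1.KillCert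

universe u

section Shift

variable {B : Type u} [CommRing B] {c : ℕ} (f : Fin c → B) (w : Fin c → ℕ) (σ : B ≃+* B)
  (hσJ : ∀ n : ℕ, ((weightedFiltration f w).ideal n).map (σ : B →+* B) ≤ (weightedFiltration f w).ideal n)
  {p : ℕ} (hp : 0 < p) (hσp : ∀ x : B, (⇑σ)^[p] x = x) (δ : ℕ)

/-- **The twisted derivation with shift `δ` on monomials**: `y ∈ 𝒥ₙ`, `σ y − y = β j` with `j ∈ 𝒥ₙ₊δ` ⇒ `σ_R (y tⁿ) − y tⁿ = (β s^δ)·(j tⁿ⁺δ)`.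
[OURS · L1 W4.5c] -/
theorem sigmaR_sub_eq_of_admissible_shift (β : B) {n : ℕ} {y j : B} (hyj : σ y - y = β * j) (z z' : ↥(cobordantAlgebra f w))
    (hz : (z : B[T;T⁻¹]) = C y * T (n : ℤ)) (hz' : (z' : B[T;T⁻¹]) = C j * T ((n + δ : ℕ) : ℤ)) :
    sigmaR σ f w hσJ hp hσp z - z = (algebraMap B (↥(cobordantAlgebra f w)) β * cobordantAlgebra.s f w ^ δ) * z' := by
  rw [← mul_cancel_right_mem_nonZeroDivisors (s_pow_mem_nonZeroDivisors f w n)]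
  have h1 : z * cobordantAlgebra.s f w ^ n = algebraMap B (↥(cobordantAlgebra f w)) y := by
    rw [algebraMap_eq_s_pow_mul f w z hz, mul_comm]
  have h2 : z' * cobordantAlgebra.s f w ^ (n + δ) = algebraMap B (↥(cobordantAlgebra f w)) j := by
    rw [algebraMap_eq_s_pow_mul f w z' hz', mul_comm]
  have h3 : sigmaR σ f w hσJ hp hσp z * cobordantAlgebra.s f w ^ n = algebraMap B (↥(cobordantAlgebra f w)) (σ y) := by
    rw [← sigmaR_algebraMap σ f w hσJ hp hσp, ← h1, map_mul, sigmaR_s_pow]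
  have h4 : algebraMap B (↥(cobordantAlgebra f w)) (σ y) - algebraMap B (↥(cobordantAlgebra f w)) y =
      algebraMap B (↥(cobordantAlgebra f w)) β * algebraMap B (↥(cobordantAlgebra f w)) j := by
    rw [← map_sub, hyj, map_mul]
  calc (sigmaR σ f w hσJ hp hσp z - z) * cobordantAlgebra.s f w ^ n
      = algebraMap B (↥(cobordantAlgebra f w)) (σ y) - algebraMap B (↥(cobordantAlgebra f w)) y := by rw [sub_mul, h3, h1]
    _ = algebraMap B (↥(cobordantAlgebra f w)) β * (z' * cobordantAlgebra.s f w ^ (n + δ)) := by rw [h4, h2]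
    _ = algebraMap B (↥(cobordantAlgebra f w)) β * cobordantAlgebra.s f w ^ δ * z' * cobordantAlgebra.s f w ^ n := by ring

/-- **(H1) from boundary-admissibility with shift `δ`**: `y ∈ 𝒥ₙ ⇒ σ y − y ∈ β 𝒥ₙ₊δ` for all `n, y` ⇒ `augIdeal σ_R ≤ (β s^δ)`. [OURS · L1 W4.5c] -/
theorem augmentationIdeal_sigmaR_le_span_of_admissible_shift (β : B)
    (hadm : ∀ (n : ℕ) (y : B), y ∈ (weightedFiltration f w).ideal n →
      σ y - y ∈ Ideal.span {β} * (weightedFiltration f w).ideal (n + δ)) :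
    augmentationIdeal (sigmaR σ f w hσJ hp hσp) ≤
      Ideal.span {algebraMap B (↥(cobordantAlgebra f w)) β * cobordantAlgebra.s f w ^ δ} := by
  rw [augmentationIdeal, Ideal.span_le]
  rintro _ ⟨z, rfl⟩
  change z ∈ ReesKill.movedWithin (sigmaR σ f w hσJ hp hσp)
    (Ideal.span {algebraMap B (↥(cobordantAlgebra f w)) β * cobordantAlgebra.s f w ^ δ})
  have hmon : ∀ (n : ℕ) (y : B) (hy : y ∈ (weightedFiltration f w).ideal n) (x : ↥(cobordantAlgebra f w)),
      (x : B[T;T⁻¹]) = C y * T (n : ℤ) →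
      x ∈ ReesKill.movedWithin (sigmaR σ f w hσJ hp hσp)
        (Ideal.span {algebraMap B (↥(cobordantAlgebra f w)) β * cobordantAlgebra.s f w ^ δ}) := by
    intro n y hy x hx
    obtain ⟨j, hj, hyj⟩ := Ideal.mem_span_singleton_mul.mp (hadm n y hy)
    rw [ReesKill.mem_movedWithin_iff,
      sigmaR_sub_eq_of_admissible_shift f w σ hσJ hp hσp δ β hyj.symm x ⟨_, C_mul_T_mem_cobordantAlgebra f w hj⟩ hx rfl]
    exact Ideal.mul_mem_right _ _ (Ideal.mem_span_singleton_self _)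
  induction z using cobordantAlgebra.induction_on with
  | algebraMap a =>
    exact hmon 0 a (mem_weightedFiltration_zero f w a) _ (by rw [cobordantAlgebra.coe_algebraMap, Nat.cast_zero, T_zero, mul_one])
  | s =>
    rw [ReesKill.mem_movedWithin_iff, sigmaR_s, sub_self]
    exact Ideal.zero_mem _
  | u' i => exact hmon (w i) (f i) (mem_weightedFiltration_ideal f w i) _ (cobordantAlgebra.coe_u' f w i)
  | add x y hx hy => exact add_mem hx hy
  | mul x y hx hy => exact mul_mem hx hy

/-- `j β ∈ augIdeal σ ⇒ j · (β s^δ) ∈ augIdeal σ_R`. [OURS · L1 W4.5c] -/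
theorem map_colon_le_colon_shift (β : B) :
    ((augmentationIdeal σ).colon (Ideal.span {β})).map (algebraMap B (↥(cobordantAlgebra f w))) ≤
      (augmentationIdeal (sigmaR σ f w hσJ hp hσp)).colon
        (Ideal.span {algebraMap B (↥(cobordantAlgebra f w)) β * cobordantAlgebra.s f w ^ δ}) := by
  rw [Ideal.map_le_iff_le_comap]
  intro j hj
  rw [Ideal.mem_comap, Ideal.mem_colon_span_singleton, ← mul_assoc, ← map_mul]
  refine Ideal.mul_mem_right _ _ ?_
  exact OneShotKill.map_augmentationIdeal_le σ (sigmaR σ f w hσJ hp hσp) (sigmaR_algebraMap σ f w hσJ hp hσp)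
    (Ideal.mem_map_of_mem _ (Ideal.mem_colon_span_singleton.mp hj))

/-- **(H2) from irrelevance and isolation, shift `δ`.** [OURS · L1 W4.5c] -/
theorem exists_vertexIdeal_pow_le_colon_shift (β : B)
    (hiso : ∃ N : ℕ, Ideal.span (Set.range f) ^ N ≤ (augmentationIdeal σ).colon (Ideal.span {β}))
    (hirr : ∃ N : ℕ, cobordantAlgebra.vertexIdeal f w ^ N ≤
      (augmentationIdeal (sigmaR σ f w hσJ hp hσp)).colon
          (Ideal.span {algebraMap B (↥(cobordantAlgebra f w)) β * cobordantAlgebra.s f w ^ δ}) ⊔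
        cobordantAlgebra.excIdeal f w) :
    ∃ N : ℕ, cobordantAlgebra.vertexIdeal f w ^ N ≤
      (augmentationIdeal (sigmaR σ f w hσJ hp hσp)).colon
        (Ideal.span {algebraMap B (↥(cobordantAlgebra f w)) β * cobordantAlgebra.s f w ^ δ}) := by
  obtain ⟨N₁, hN₁⟩ := hiso
  obtain ⟨N₂, hN₂⟩ := hirr
  refine Ideal.exists_pow_le_of_le_radical_of_fg ?_ (Submodule.fg_span (Set.finite_range _))
  rw [Ideal.radical_eq_sInf, le_sInf_iff]
  rintro P ⟨haP, hP⟩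
  rw [cobordantAlgebra.vertexIdeal, Ideal.span_le]
  rintro _ ⟨i, rfl⟩
  by_cases hs : cobordantAlgebra.s f w ∈ P
  · have hle : cobordantAlgebra.vertexIdeal f w ^ N₂ ≤ P := by
      refine hN₂.trans (sup_le haP ?_)
      rw [cobordantAlgebra.excIdeal, Ideal.span_singleton_le_iff_mem]
      exact hs
    exact hP.mem_of_pow_mem N₂ (hle (Ideal.pow_mem_pow (cobordantAlgebra.u'_mem_vertexIdeal f w i) N₂))
  · have hfi : algebraMap B (↥(cobordantAlgebra f w)) (f i) ∈ P := by
      refine hP.mem_of_pow_mem N₁ ?_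
      rw [← map_pow]
      refine haP (map_colon_le_colon_shift f w σ hσJ hp hσp δ β (Ideal.mem_map_of_mem _ (hN₁ ?_)))
      exact Ideal.pow_mem_pow (Ideal.subset_span (Set.mem_range_self i)) N₁
    rw [cobordantAlgebra.algebraMap_u] at hfi
    exact (hP.mem_or_mem hfi).resolve_left fun h => hs (hP.mem_of_pow_mem _ h)

/-- ★★ **KC3_δ — THE INITIAL-FORM KILL CRITERION WITH SHIFT `δ`.** (a′)_δ `y ∈ 𝒥ₙ ⇒ σ y − y ∈ β 𝒥ₙ₊δ`, (ii) isolation `(f)^N ≤ (augIdeal σ : β)`,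
(i)_δ `vertexIdeal^N ≤ (augIdeal σ_R : β s^δ) ⊔ (s)` ⇒ `β s^δ` is a cobordant kill certificate (so `augIdeal σʼ = (β s^δ)` on every σ-fixed chart, KC1).
The census' trA root kill `(2,3)` has `δ = 3`. [OURS · L1 W4.5c · ASSIGNMENT v10.25 (3); NOT a statement of the manuscript] -/
theorem cobordantKillCert_of_admissible_of_irrelevant_shift (β : B)
    (hadm : ∀ (n : ℕ) (y : B), y ∈ (weightedFiltration f w).ideal n →
      σ y - y ∈ Ideal.span {β} * (weightedFiltration f w).ideal (n + δ))
    (hiso : ∃ N : ℕ, Ideal.span (Set.range f) ^ N ≤ (augmentationIdeal σ).colon (Ideal.span {β}))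
    (hirr : ∃ N : ℕ, cobordantAlgebra.vertexIdeal f w ^ N ≤
      (augmentationIdeal (sigmaR σ f w hσJ hp hσp)).colon
          (Ideal.span {algebraMap B (↥(cobordantAlgebra f w)) β * cobordantAlgebra.s f w ^ δ}) ⊔
        cobordantAlgebra.excIdeal f w) :
    CobordantKillCert f w σ hσJ hp hσp (algebraMap B (↥(cobordantAlgebra f w)) β * cobordantAlgebra.s f w ^ δ) := by
  refine ⟨augmentationIdeal_sigmaR_le_span_of_admissible_shift f w σ hσJ hp hσp δ β hadm, ?_⟩
  obtain ⟨N, hN⟩ := exists_vertexIdeal_pow_le_colon_shift f w σ hσJ hp hσp δ β hiso hirr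
  refine ⟨N, (Ideal.mul_mono_right hN).trans ?_⟩
  rw [Ideal.mul_le]
  intro r hr a ha
  obtain ⟨r', rfl⟩ := Ideal.mem_span_singleton'.mp hr
  rw [mul_assoc, mul_comm _ a]
  exact Ideal.mul_mem_left _ _ (Ideal.mem_colon_span_singleton.mp ha)

/-! ## (a′)_δ: consequences and generators -/

/-- (a′)_δ ⇒ σ-adaptedness. [OURS · L1 W4.5c] -/
theorem map_le_of_admissible_shift (β : B)
    (hadm : ∀ (n : ℕ) (y : B), y ∈ (weightedFiltration f w).ideal n →
      σ y - y ∈ Ideal.span {β} * (weightedFiltration f w).ideal (n + δ)) (n : ℕ) :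
    ((weightedFiltration f w).ideal n).map (σ : B →+* B) ≤ (weightedFiltration f w).ideal n := by
  rw [Ideal.map_le_iff_le_comap]
  intro y hy
  rw [Ideal.mem_comap, RingHom.coe_coe, ← sub_add_cancel (σ y) y]
  refine Ideal.add_mem _ ?_ hy
  exact (weightedFiltration f w).antitone (Nat.le_add_right n δ) (Ideal.mul_le_left (hadm n y hy))

/-- The twisted Leibniz rule with shift `δ`. [OURS · L1 W4.5c] -/
theorem sub_mem_of_mul_shift (β : B) {m n : ℕ} {a b : B} (ha : a ∈ (weightedFiltration f w).ideal m)
    (hb : b ∈ (weightedFiltration f w).ideal n)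
    (hσa : σ a - a ∈ Ideal.span {β} * (weightedFiltration f w).ideal (m + δ))
    (hσb : σ b - b ∈ Ideal.span {β} * (weightedFiltration f w).ideal (n + δ)) :
    σ (a * b) - a * b ∈ Ideal.span {β} * (weightedFiltration f w).ideal (m + n + δ) := by
  have hσa' : σ a ∈ (weightedFiltration f w).ideal m := by
    rw [← sub_add_cancel (σ a) a]
    exact Ideal.add_mem _ ((weightedFiltration f w).antitone (Nat.le_add_right m δ) (Ideal.mul_le_left hσa)) ha
  have e : σ (a * b) - a * b = σ a * (σ b - b) + (σ a - a) * b := by rw [map_mul]; ring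
  rw [e]
  refine Ideal.add_mem _ ?_ ?_
  · have h1 : σ a * (σ b - b) ∈ (weightedFiltration f w).ideal m * (Ideal.span {β} * (weightedFiltration f w).ideal (n + δ)) :=
      Ideal.mul_mem_mul hσa' hσb
    rw [mul_left_comm] at h1
    have h2 := Ideal.mul_mono_right (I := Ideal.span {β}) ((weightedFiltration f w).mul_le m (n + δ)) h1
    rwa [show m + (n + δ) = m + n + δ by ring] at h2
  · have h1 : (σ a - a) * b ∈ Ideal.span {β} * (weightedFiltration f w).ideal (m + δ) * (weightedFiltration f w).ideal n :=
      Ideal.mul_mem_mul hσa hb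
    rw [mul_assoc] at h1
    have h2 := Ideal.mul_mono_right (I := Ideal.span {β}) ((weightedFiltration f w).mul_le (m + δ) n) h1
    rwa [show m + δ + n = m + n + δ by ring] at h2

/-- ★ **(a′)_δ is checked on generators**: `σ g − g ∈ β 𝒥_δ` for `g` in a generating set of `B` and `σ fᵢ − fᵢ ∈ β 𝒥_{wᵢ+δ}` for the centre ⇒
`y ∈ 𝒥ₙ ⇒ σ y − y ∈ β 𝒥ₙ₊δ` for all `n, y`. [OURS · L1 W4.5c] -/
theorem admissible_shift_of_generators (β : B) (G : Set B) (hG : Subring.closure G = ⊤)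
    (h0 : ∀ g ∈ G, σ g - g ∈ Ideal.span {β} * (weightedFiltration f w).ideal δ)
    (hf : ∀ i, σ (f i) - f i ∈ Ideal.span {β} * (weightedFiltration f w).ideal (w i + δ)) (n : ℕ) (y : B)
    (hy : y ∈ (weightedFiltration f w).ideal n) :
    σ y - y ∈ Ideal.span {β} * (weightedFiltration f w).ideal (n + δ) := by
  have hall : ∀ b : B, σ b - b ∈ Ideal.span {β} * (weightedFiltration f w).ideal δ := by
    intro b
    have hb : b ∈ ReesKill.movedWithin σ (Ideal.span {β} * (weightedFiltration f w).ideal δ) := by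
      have hle : Subring.closure G ≤ ReesKill.movedWithin σ (Ideal.span {β} * (weightedFiltration f w).ideal δ) :=
        Subring.closure_le.mpr fun g hg => h0 g hg
      exact hle (by rw [hG]; trivial)
    exact hb
  have hall' : ∀ b : B, σ b - b ∈ Ideal.span {β} * (weightedFiltration f w).ideal (0 + δ) := fun b => by
    rw [zero_add]; exact hall b
  have hmon : ∀ α : Fin c →₀ ℕ, σ (α.prod fun i e => f i ^ e) - α.prod (fun i e => f i ^ e) ∈
      Ideal.span {β} * (weightedFiltration f w).ideal (Finsupp.weight w α + δ) := by
    intro α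
    induction α using Finsupp.induction with
    | zero =>
      rw [Finsupp.prod_zero_index, map_zero]
      exact hall' 1
    | single_add i k α hi hk ih =>
      rw [prod_pow_add, map_add, Finsupp.weight_single, smul_eq_mul,
        Finsupp.prod_single_index (h := fun i e => f i ^ e) (pow_zero _)]
      have hpow : ∀ l : ℕ, f i ^ l ∈ (weightedFiltration f w).ideal (l * w i) ∧
          σ (f i ^ l) - f i ^ l ∈ Ideal.span {β} * (weightedFiltration f w).ideal (l * w i + δ) := by
        intro l
        induction l with
        | zero =>
          refine ⟨by rw [zero_mul, (weightedFiltration f w).ideal_zero]; trivial, ?_⟩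
          rw [pow_zero, zero_mul]
          exact hall' 1
        | succ l ihl =>
          refine ⟨?_, ?_⟩
          · have := (weightedFiltration f w).mul_le _ _ (Ideal.mul_mem_mul ihl.1 (mem_weightedFiltration_ideal f w i))
            rwa [← pow_succ, show l * w i + w i = (l + 1) * w i by ring] at this
          · have := sub_mem_of_mul_shift f w σ δ β ihl.1 (mem_weightedFiltration_ideal f w i) ihl.2 (hf i)
            rwa [← pow_succ, show l * w i + w i + δ = (l + 1) * w i + δ by ring] at this
      have hrest : α.prod (fun i e => f i ^ e) ∈ (weightedFiltration f w).ideal (Finsupp.weight w α) :=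
        Ideal.subset_span ⟨α, le_rfl, rfl⟩
      have := sub_mem_of_mul_shift f w σ δ β (hpow k).1 hrest (hpow k).2 ih
      rwa [show k * w i + Finsupp.weight w α + δ = k * w i + Finsupp.weight w α + δ by ring] at this
  rw [weightedFiltration_ideal] at hy
  induction hy using Submodule.span_induction with
  | mem m hm =>
    obtain ⟨α, hα, rfl⟩ := hm
    exact Ideal.mul_mono_right ((weightedFiltration f w).antitone (Nat.add_le_add_right hα δ)) (hmon α)
  | zero =>
    rw [map_zero, sub_zero]
    exact Ideal.zero_mem _
  | add a b _ _ ha hb =>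
    have e : σ (a + b) - (a + b) = (σ a - a) + (σ b - b) := by rw [map_add]; ring
    rw [e]
    exact Ideal.add_mem _ ha hb
  | smul r a ha' ha =>
    rw [smul_eq_mul]
    have := sub_mem_of_mul_shift f w σ δ β (mem_weightedFiltration_zero f w r) (by rw [weightedFiltration_ideal]; exact ha') (hall' r) ha
    rwa [zero_add] at this

end Shift

section Node

variable {p : ℕ} {m : ℕ} (r : Fin m → ℕ) (B : Type u) [CommRing B] (𝒜 : (Π j : Fin m, ZMod (r j)) → AddSubgroup B)
  [GradedRing 𝒜] (σ : B ≃+* B)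

/-- ★★ **KC2 ∘ KC3_δ: ring kill data from the shifted criterion.** Centre data + (a′)_δ + (ii) + (i)_δ (for every admissible `(hp, hσp)`) ⇒
`RingKillData p r B 𝒜 σ`. [OURS · L1 W4.5c · ASSIGNMENT v10.25 (3); NOT a statement of the manuscript] -/
theorem ringKillData_of_admissible_of_irrelevant_shift {c : ℕ} (f : Fin c → B) (δ' : Fin c → Π j : Fin m, ZMod (r j)) (w : Fin c → ℕ)
    (d : ℕ) (hc : 0 < c) (hf : ∀ i, f i ∈ 𝒜 (δ' i)) (hw : ∀ i, 0 < w i)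
    (hK1 : RingTheory.Sequence.IsRegular B (List.ofFn f)) (hK1' : IsRegularRing (B ⧸ Ideal.span (Set.range f)))
    (hver : VeroneseNormalised 𝒜 f w d) (β : B) (δ : ℕ)
    (hadm : ∀ (n : ℕ) (y : B), y ∈ (weightedFiltration f w).ideal n →
      σ y - y ∈ Ideal.span {β} * (weightedFiltration f w).ideal (n + δ))
    (hiso : ∃ N : ℕ, Ideal.span (Set.range f) ^ N ≤ (augmentationIdeal σ).colon (Ideal.span {β}))
    (hirr : ∀ (hp : 0 < p) (hσp : ∀ x : B, (⇑σ)^[p] x = x), ∃ N : ℕ, cobordantAlgebra.vertexIdeal f w ^ N ≤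
      (augmentationIdeal (sigmaR σ f w (map_le_of_admissible_shift f w σ δ β hadm) hp hσp)).colon
          (Ideal.span {algebraMap B (↥(cobordantAlgebra f w)) β * cobordantAlgebra.s f w ^ δ}) ⊔
        cobordantAlgebra.excIdeal f w) :
    RingKillData p r B 𝒜 σ :=
  ringKillData_of_cert r B 𝒜 σ f δ' w d hc hf hw hK1 hK1' (map_le_of_admissible_shift f w σ δ β hadm) hver fun hp hσp =>
    ⟨_, cobordantKillCert_of_admissible_of_irrelevant_shift f w σ _ hp hσp δ β hadm hiso (hirr hp hσp)⟩

end Node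

end Summit.ResolutionOfSingularities.ResolutionOfSingularities.Theorems.WildQuotientResolution.S1.KillCert

end
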